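import Summits.ResolutionOfSingularities.ResolutionOfSingularities.Theorems.FrobeniusLadderFInjectiveMacaulayficationFiniteResidualOfIsolatedGerm
import Summits.ResolutionOfSingularities.ResolutionOfSingularities.Theorems.FrobeniusLadderFInjectiveMacaulayficationRegularBlowupModelDim2
import Summits.ResolutionOfSingularities.ResolutionOfSingularities.Theorems.FrobeniusLadderFInjectiveMacaulayficationRegularPointClause
import Literature.AlgebraicGeometry.Resolution.Temkin2008Localization
import Literature.AlgebraicGeometry.Resolution.BlowupsFlatBaseChange
import HarnessLib

/-!
# FC″ at EVERY bad non-closed point ⟸ (T3ᵃ′), given THEOREM A «the model is regular off finitely many closed points of the base»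
# (crux `FInjectiveMacaulayfication` stmt-ResolutionOfSingularities-15315, chain w45a; res-L1-w45a-plan-1 RULINGS R16.59/R16.60, interface I-D of
# res-L1-w45a-lead-1 22:59:07Z — file 4 `…FiniteResidualOfFourfold`; THEOREM A itself = `DesingularizationOffClosedPoints.desingularization_offFinite_of_local`
# (I-A, lead-1) fed by the local Cossart–Piltant desingularizations (I-B, res-L1-w45a-stub-1) and the dimension count (I-C, res-L1-w45a-stub-3);
# seat res-L1-w45a-lead-1 g7)

[OURS · L1 W4.5a] Support file (`--supports stmt-ResolutionOfSingularities-15315 --as helper`); replaces the role of NO printed item; NOT a statement of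
the manuscript; def-free; no named fact (THEOREM A enters as the HYPOTHESIS `hA` — the exact output shape of `desingularization_offFinite_of_local` —
and (T3ᵃ′) `AbsorbingStep.AbsorbingClosedPointStepNC` is a CANDIDATE statement of OURS); AI-written (AI review is weaker than expert review).

THE POINT (why hole #3 collapses on 4-folds). THEOREM A hands us ONE blowing up `f : X′ → X₁` along `J` (`supp J ⊆ Sing X₁`) that is REGULAR over
`X₁ ∖ F` for a FINITE set `F` of CLOSED points. For every blowing up along `J` (all isomorphic to `X′`) this means: FULL at every point over `X₁ ∖ F`
(regular ⇒ domain ∧ CM-clause ∧ F-clause, `RegularPointClause`), i.e. `GoodOver p X₁ J (X₁ ∖ F)` (`goodOver_of_isBlowup_regularOver`). At a NON-closed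
point `η` where `𝒪_{X₁,η}` is not regular: `η ∈ supp J` (else `f` is a stalk isomorphism over `η` onto a regular stalk), `η ∉ F`, and the (A′) LocFix
datum at `η` is RE-DERIVED from goodness near `η` (`AbsorbingStep.locFixData_of_goodOver_nhd`, res-L1-w45a-stub-1). With `V := X₁ ∖ (F ∖ supp J)`
(open: `F` is a finite set of closed points) and `Z := F ∩ supp J` this is VERBATIM the finite-residual hypothesis of
`RelClosedFixR.FCUnguardedOfFiniteResidualR` (`finiteResidualR_hyp_of_regularOffFinite`). Hence, by res-L1-w45a-stub-1's
`fcUnguardedOfFiniteResidualR_of_absorbingStepNC` (p575338): **the conclusion of FC″ holds at every bad non-closed `η` of such an `X₁`, modulo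
(T3ᵃ′) alone** (`fcUnguarded_of_absorbingStepNC_of_regularOffFinite`) — the TERMINATION content (i) of hole #3 is discharged by THEOREM A, what
remains is the ABSORPTION of the finitely many closed residual points = the d = 4 closed core in `GoodOver` currency.
[folklore assembly; cite: Temkin2008, Prop. 2.3.4; StacksProject, Tag 02OS, Tag 0804; Matsumura1987, Thm. 17.4; Kunz1969, Thm. 2.1]
-/

-- single-problem summit: the doubled namespace component is forced
set_option linter.dupNamespace false

noncomputable section

namespace Summit.ResolutionOfSingularities.ResolutionOfSingularities.Theorems.FInjectiveMacaulayfication.FiniteResidualOfFourfold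

open CategoryTheory CategoryTheory.Limits AlgebraicGeometry TopologicalSpace IsLocalRing
open Literature.AlgebraicGeometry.Resolution
open Summit.ResolutionOfSingularities.ResolutionOfSingularities.Theorems.FInjectiveMacaulayfication
open SliceableCentre FCUnguardedAprime

/-! ## §1 A blowing up that is regular over `W` makes its centre good over `W` -/

/-- **Regular over `W` ⇒ `GoodOver W`.** If ONE blowing up `f : X′ → X₁` along `J` is regular at every point over `W ⊆ X₁`, then EVERY blowing up
along `J` is FULL at every point over `W` (uniqueness of blowing ups; regular ⇒ FULL in characteristic `p`), in particular `GoodOver p X₁ J W`.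
[folklore; cite: Matsumura1987, Thm. 17.4; Kunz1969, Thm. 2.1] -/
theorem full_of_isBlowup_regularOver (p : ℕ) [Fact p.Prime] {k : Type} [Field k] [CharP k p] {X₁ X' : Scheme.{0}}
    (f₁ : X₁ ⟶ Spec (.of k)) {f : X' ⟶ X₁} {J : X₁.IdealSheafData} (hf : IsBlowup f J) (W : Set X₁)
    (hreg : ∀ x' : X', f x' ∈ W → x' ∈ Scheme.regularLocus X') :
    ∀ (X₂ : Scheme.{0}) (π : X₂ ⟶ X₁), IsBlowup π J → ∀ x : X₂, π.base x ∈ W → FullCl p (X₂.presheaf.stalk x) := by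
  intro X₂ π hπ x hx
  obtain ⟨e, he, he'⟩ := hf.unique hπ
  -- `x = e (e⁻¹ x)` and `f (e⁻¹ x) = π x ∈ W`
  have hx' : f (e.inv x) ∈ W := by
    have h1 : f (e.inv x) = π x := by rw [← Scheme.Hom.comp_apply, he']
    rw [h1]
    exact hx
  have hreg' : e.inv x ∈ Scheme.regularLocus X' := hreg _ hx'
  have hregx : x ∈ Scheme.regularLocus X₂ := by
    have h2 : e.hom (e.inv x) = x := by
      rw [← Scheme.Hom.comp_apply, Iso.inv_hom_id]
      rfl
    rw [← h2]
    exact (mem_regularLocus_iff_of_flat_of_isPreimmersion e.hom (e.inv x)).mp hreg'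
  exact RegularPointClause.fiClause_stalk_of_isRegularLocalRing p (π ≫ f₁) x ((Scheme.mem_regularLocus x).mp hregx)

/-- The `GoodOver` form of `full_of_isBlowup_regularOver`. [folklore] -/
theorem goodOver_of_isBlowup_regularOver (p : ℕ) [Fact p.Prime] {k : Type} [Field k] [CharP k p] {X₁ X' : Scheme.{0}}
    (f₁ : X₁ ⟶ Spec (.of k)) {f : X' ⟶ X₁} {J : X₁.IdealSheafData} (hf : IsBlowup f J) (W : Set X₁)
    (hreg : ∀ x' : X', f x' ∈ W → x' ∈ Scheme.regularLocus X') : GoodOver p X₁ J W := fun X₂ π hπ =>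
  ⟨fun x hx _ => full_of_isBlowup_regularOver p f₁ hf W hreg X₂ π hπ x hx,
    fun x hx _ => RelClosedSubsetFixFinite.cmCl_of_fullCl (full_of_isBlowup_regularOver p f₁ hf W hreg X₂ π hπ x hx)⟩

/-! ## §2 The finite-residual hypothesis at every bad non-closed point, from THEOREM A -/

/-- **THEOREM A ⇒ the finite-residual hypothesis of `FCUnguardedOfFiniteResidualR` at every bad non-closed point.** Let `f : X′ → X₁` be a blowing
up along `J` with `supp J ⊆ Sing X₁`, regular over `X₁ ∖ F` for a finite set `F` of closed points (the output of
`DesingularizationOffClosedPoints.desingularization_offFinite_of_local`). Then at every NON-closed `η` with `𝒪_{X₁,η}` not regular there are an (A′)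
LocFix datum `c′`, `J₀ := J` with `J_η = (c′)`, `V := X₁ ∖ (F ∖ supp J)` and `Z := F ∩ supp J` — finite, closed, `η ∉ Z ⊆ supp J ⊆ V` — with
`GoodOver p X₁ J (V ∖ Z)`. [folklore assembly; cite: StacksProject, Tag 02OS, Tag 0804] -/
theorem finiteResidualR_hyp_of_regularOffFinite (p : ℕ) (hp : p.Prime) (k : Type) [Field k] [CharP k p]
    (X₁ : Scheme.{0}) (f₁ : X₁ ⟶ Spec (.of k)) [LocallyOfFiniteType f₁] [IsIntegral X₁]
    (hA : ∃ (X' : Scheme.{0}) (f : X' ⟶ X₁) (J : X₁.IdealSheafData) (F : Set X₁), IsBlowup f J ∧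
      (J.support : Set X₁) ⊆ (Scheme.regularLocus X₁)ᶜ ∧ IsClosed F ∧ F.Finite ∧ (∀ b ∈ F, IsClosed ({b} : Set X₁)) ∧
      ∀ x' : X', f x' ∉ F → x' ∈ Scheme.regularLocus X')
    (η : X₁) (hη : ¬ IsClosed ({η} : Set X₁)) (hsing : ¬ IsRegularLocalRing (X₁.presheaf.stalk η)) :
    ∃ (n' : ℕ) (c' : Fin n' → X₁.presheaf.stalk η) (J₀ : X₁.IdealSheafData) (V : X₁.Opens) (Z : Set X₁),
      LocFixData p X₁ η n' c' ∧ stalkIdeal J₀ η = Ideal.span (Set.range c') ∧ IsClosed Z ∧ Z.Finite ∧ η ∉ Z ∧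
        Z ⊆ (J₀.support : Set X₁) ∧ (J₀.support : Set X₁) ⊆ (V : Set X₁) ∧ GoodOver p X₁ J₀ ((V : Set X₁) \ Z) := by
  classical
  haveI : Fact p.Prime := ⟨hp⟩
  haveI : IsLocallyNoetherian X₁ := LocallyOfFiniteType.isLocallyNoetherian f₁
  obtain ⟨X', f, J, F, hf, hJsupp, hFcl, hFfin, hFpts, hreg⟩ := hA
  -- `J ≠ ⊥`: the generic point is regular, hence off `supp J`
  have hJ : J ≠ ⊥ := by
    intro h
    have hmem : genericPoint X₁ ∈ (J.support : Set X₁) := by rw [h, Scheme.IdealSheafData.support_bot]; trivial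
    exact hJsupp hmem (genericPoint_mem_regularLocus X₁)
  -- `η ∈ supp J`: otherwise `f` is a stalk isomorphism over `η` onto a REGULAR stalk (`η ∉ F` is non-closed)
  have hηF : η ∉ F := fun h => hη (hFpts η h)
  have hηJ : η ∈ (J.support : Set X₁) := by
    by_contra hηJ
    obtain ⟨x', hx'⟩ := RegularBlowupModelDim2.exists_preimage_of_isBlowup_of_not_mem hf η hηJ
    haveI := RegularBlowupModelDim2.isIso_stalkMap_of_isBlowup_of_not_mem hf x' (hx'.symm ▸ hηJ)
    have hregx' : x' ∈ Scheme.regularLocus X' := hreg x' (by rw [show f x' = η from hx']; exact hηF)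
    haveI : IsRegularLocalRing (X'.presheaf.stalk x') := (Scheme.mem_regularLocus x').mp hregx'
    apply hsing
    have e : X₁.presheaf.stalk (f.base x') ≃+* X'.presheaf.stalk x' := (asIso (f.stalkMap x')).commRingCatIsoToRingEquiv
    rw [← show f.base x' = η from hx']
    exact IsRegularLocalRing.of_ringEquiv e.symm
  -- goodness over `X₁ ∖ F`
  let U : X₁.Opens := ⟨Fᶜ, hFcl.isOpen_compl⟩
  have hgoodU : GoodOver p X₁ J (U : Set X₁) :=
    goodOver_of_isBlowup_regularOver p f₁ hf (U : Set X₁) (fun x' hx' => hreg x' hx')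
  -- the LocFix datum at `η`, re-derived from goodness near `η`
  obtain ⟨n', c', hc⟩ := Submodule.fg_iff_exists_fin_generating_family.mp (IsNoetherian.noetherian (stalkIdeal J η))
  have hc' : Ideal.span (Set.range c') = stalkIdeal J η := hc
  have hdat : LocFixData p X₁ η n' c' := AbsorbingStep.locFixData_of_goodOver_nhd p (U := U) hηF hη hJ hηJ hgoodU c' hc'
  -- `V := X₁ ∖ (F ∖ supp J)` (open: a finite set of closed points is closed) and `Z := F ∩ supp J`
  have hFJcl : IsClosed (F \ (J.support : Set X₁)) := by
    rw [← Set.biUnion_of_singleton (F \ (J.support : Set X₁))]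
    exact (hFfin.subset fun x hx => hx.1).isClosed_biUnion fun b hb => hFpts b hb.1
  let V : X₁.Opens := ⟨(F \ (J.support : Set X₁))ᶜ, hFJcl.isOpen_compl⟩
  refine ⟨n', c', J, V, F ∩ (J.support : Set X₁), hdat, hc'.symm, hFcl.inter J.support.isClosed,
    hFfin.subset Set.inter_subset_left, fun h => hηF h.1, Set.inter_subset_right, fun x hx hxF => hxF.2 hx, ?_⟩
  -- `V ∖ Z ⊆ X₁ ∖ F`
  refine RelClosedSubsetFixFinite.goodOver_mono ?_ hgoodU
  intro x hx hxF
  by_cases hxJ : x ∈ (J.support : Set X₁)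
  · exact hx.2 ⟨hxF, hxJ⟩
  · exact hx.1 ⟨hxF, hxJ⟩

/-! ## §3 FC″ at every bad non-closed point, modulo (T3ᵃ′), given THEOREM A -/

/-- **FC″ AT EVERY BAD NON-CLOSED POINT ⟸ (T3ᵃ′) + THEOREM A.** Assume res-L1-w45a-stub-1's candidate step `AbsorbingClosedPointStepNC`. Let `X₁` satisfy the
binders of FC″ (integral separated `k`-scheme of finite type, `dim ≥ 4`, Cohen–Macaulay stalks) AND the conclusion of THEOREM A (a blowing up regular off
finitely many closed points of `X₁`, centre in `Sing X₁` — on 4-folds: `DesingularizationOffClosedPoints.desingularization_offFinite_of_local` with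
Cossart–Piltant). Then the conclusion of FC″ holds at EVERY non-closed F-bad `η` of `X₁` (no local-dimension, isolation or curve hypothesis).
[OURS · conditional on the CANDIDATE (T3ᵃ′); THEOREM A as hypothesis] -/
theorem fcUnguarded_of_absorbingStepNC_of_regularOffFinite (h : AbsorbingStep.AbsorbingClosedPointStepNC)
    (p : ℕ) (hp : p.Prime) (k : Type) [Field k] [CharP k p] (X₁ : Scheme.{0}) (f₁ : X₁ ⟶ Spec (.of k))
    (hs : IsSeparated f₁) (hft : LocallyOfFiniteType f₁) (hqc : QuasiCompact f₁) (hi : IsIntegral X₁) (h4 : 4 ≤ topologicalKrullDim X₁)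
    (hCM : ∀ x : X₁, (∀ d : ℕ, ringKrullDim (X₁.presheaf.stalk x) = d → ∀ s : Fin d → X₁.presheaf.stalk x,
        (Ideal.span (Set.range s)).radical.IsMaximal → RingTheory.Sequence.IsWeaklyRegular (X₁.presheaf.stalk x) (List.ofFn s)))
    (hA : ∃ (X' : Scheme.{0}) (f : X' ⟶ X₁) (J : X₁.IdealSheafData) (F : Set X₁), IsBlowup f J ∧
      (J.support : Set X₁) ⊆ (Scheme.regularLocus X₁)ᶜ ∧ IsClosed F ∧ F.Finite ∧ (∀ b ∈ F, IsClosed ({b} : Set X₁)) ∧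
      ∀ x' : X', f x' ∉ F → x' ∈ Scheme.regularLocus X')
    (η : X₁)
    (hη : ¬ IsClosed ({η} : Set X₁) ∧ ¬ (∀ d : ℕ, ringKrullDim (X₁.presheaf.stalk η) = d → ∀ s : Fin d → X₁.presheaf.stalk η,
          (Ideal.span (Set.range s)).radical.IsMaximal → ∀ t : X₁.presheaf.stalk η, (∃ e : ℕ, t ^ p ^ e ∈
            Ideal.span ((fun z : X₁.presheaf.stalk η => z ^ p ^ e) '' (Ideal.span (Set.range s) : Set (X₁.presheaf.stalk η)))) →
              t ∈ Ideal.span (Set.range s)) ∧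
        ∀ y : X₁, y ⤳ η → y ≠ η → (∀ d : ℕ, ringKrullDim (X₁.presheaf.stalk y) = d → ∀ s : Fin d → X₁.presheaf.stalk y,
          (Ideal.span (Set.range s)).radical.IsMaximal → ∀ t : X₁.presheaf.stalk y, (∃ e : ℕ, t ^ p ^ e ∈
            Ideal.span ((fun z : X₁.presheaf.stalk y => z ^ p ^ e) '' (Ideal.span (Set.range s) : Set (X₁.presheaf.stalk y)))) →
              t ∈ Ideal.span (Set.range s))) :
    ∃ (J : X₁.IdealSheafData) (n' : ℕ) (c' : Fin n' → X₁.presheaf.stalk η), J ≠ ⊥ ∧ η ∈ (J.support : Set X₁) ∧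
      Ideal.span (Set.range c') ≠ ⊥ ∧ Ideal.span (Set.range c') ≤ maximalIdeal (X₁.presheaf.stalk η) ∧
        (∀ (j : Fin n') (𝔔 : PrimeSpectrum (blowupAlgebra (Ideal.span (Set.range c')) (c' j))),
          𝔔.asIdeal.comap (algebraMap (X₁.presheaf.stalk η) (blowupAlgebra (Ideal.span (Set.range c')) (c' j))) =
            maximalIdeal (X₁.presheaf.stalk η) →
          IsDomain (Localization.AtPrime 𝔔.asIdeal) ∧ ∀ d : ℕ, ringKrullDim (Localization.AtPrime 𝔔.asIdeal) = d →
            ∀ s : Fin d → Localization.AtPrime 𝔔.asIdeal, (Ideal.span (Set.range s)).radical.IsMaximal →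
              RingTheory.Sequence.IsWeaklyRegular (Localization.AtPrime 𝔔.asIdeal) (List.ofFn s) ∧
              ∀ y : Localization.AtPrime 𝔔.asIdeal, (∃ e : ℕ, y ^ p ^ e ∈ Ideal.span ((fun z : Localization.AtPrime 𝔔.asIdeal => z ^ p ^ e) ''
                (Ideal.span (Set.range s) : Set (Localization.AtPrime 𝔔.asIdeal)))) → y ∈ Ideal.span (Set.range s)) ∧
      stalkIdeal J η = Ideal.span (Set.range c') ∧
      (∀ (X₂ : Scheme.{0}) (π : X₂ ⟶ X₁), IsBlowup π J →
        (∀ x : X₂, π.base x ∈ (J.support : Set X₁) → π.base x ≠ η → ¬ IsClosed ({x} : Set X₂) →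
          IsDomain (X₂.presheaf.stalk x) ∧ ∀ d : ℕ, ringKrullDim (X₂.presheaf.stalk x) = d → ∀ s : Fin d → X₂.presheaf.stalk x,
            (Ideal.span (Set.range s)).radical.IsMaximal → RingTheory.Sequence.IsWeaklyRegular (X₂.presheaf.stalk x) (List.ofFn s) ∧
            ∀ t : X₂.presheaf.stalk x, (∃ e : ℕ, t ^ p ^ e ∈ Ideal.span ((fun z : X₂.presheaf.stalk x => z ^ p ^ e) ''
              (Ideal.span (Set.range s) : Set (X₂.presheaf.stalk x)))) → t ∈ Ideal.span (Set.range s)) ∧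
        (∀ x : X₂, π.base x ∈ (J.support : Set X₁) → IsClosed ({x} : Set X₂) →
          ∀ d : ℕ, ringKrullDim (X₂.presheaf.stalk x) = d → ∀ s : Fin d → X₂.presheaf.stalk x,
            (Ideal.span (Set.range s)).radical.IsMaximal → RingTheory.Sequence.IsWeaklyRegular (X₂.presheaf.stalk x) (List.ofFn s))) := by
  haveI : Fact p.Prime := ⟨hp⟩
  haveI := hft
  haveI := hi
  have hsing : ¬ IsRegularLocalRing (X₁.presheaf.stalk η) :=
    FiniteResidualOfIsolatedGerm.not_isRegularLocalRing_of_not_fCl p f₁ η hη.2.1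
  exact AbsorbingStep.fcUnguardedOfFiniteResidualR_of_absorbingStepNC h p hp k X₁ f₁ hs hft hqc hi h4 hCM η hη
    (finiteResidualR_hyp_of_regularOffFinite p hp k X₁ f₁ hA η hη.1 hsing)

/-- The same modulo the stronger (T3ᵃ) `AbsorbingClosedPointStep` of record. [OURS · conditional on the CANDIDATE (T3ᵃ); THEOREM A as hypothesis] -/
theorem fcUnguarded_of_absorbingStep_of_regularOffFinite (h : AbsorbingStep.AbsorbingClosedPointStep)
    (p : ℕ) (hp : p.Prime) (k : Type) [Field k] [CharP k p] (X₁ : Scheme.{0}) (f₁ : X₁ ⟶ Spec (.of k))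
    (hs : IsSeparated f₁) (hft : LocallyOfFiniteType f₁) (hqc : QuasiCompact f₁) (hi : IsIntegral X₁) (h4 : 4 ≤ topologicalKrullDim X₁)
    (hCM : ∀ x : X₁, (∀ d : ℕ, ringKrullDim (X₁.presheaf.stalk x) = d → ∀ s : Fin d → X₁.presheaf.stalk x,
        (Ideal.span (Set.range s)).radical.IsMaximal → RingTheory.Sequence.IsWeaklyRegular (X₁.presheaf.stalk x) (List.ofFn s)))
    (hA : ∃ (X' : Scheme.{0}) (f : X' ⟶ X₁) (J : X₁.IdealSheafData) (F : Set X₁), IsBlowup f J ∧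
      (J.support : Set X₁) ⊆ (Scheme.regularLocus X₁)ᶜ ∧ IsClosed F ∧ F.Finite ∧ (∀ b ∈ F, IsClosed ({b} : Set X₁)) ∧
      ∀ x' : X', f x' ∉ F → x' ∈ Scheme.regularLocus X')
    (η : X₁)
    (hη : ¬ IsClosed ({η} : Set X₁) ∧ ¬ (∀ d : ℕ, ringKrullDim (X₁.presheaf.stalk η) = d → ∀ s : Fin d → X₁.presheaf.stalk η,
          (Ideal.span (Set.range s)).radical.IsMaximal → ∀ t : X₁.presheaf.stalk η, (∃ e : ℕ, t ^ p ^ e ∈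
            Ideal.span ((fun z : X₁.presheaf.stalk η => z ^ p ^ e) '' (Ideal.span (Set.range s) : Set (X₁.presheaf.stalk η)))) →
              t ∈ Ideal.span (Set.range s)) ∧
        ∀ y : X₁, y ⤳ η → y ≠ η → (∀ d : ℕ, ringKrullDim (X₁.presheaf.stalk y) = d → ∀ s : Fin d → X₁.presheaf.stalk y,
          (Ideal.span (Set.range s)).radical.IsMaximal → ∀ t : X₁.presheaf.stalk y, (∃ e : ℕ, t ^ p ^ e ∈
            Ideal.span ((fun z : X₁.presheaf.stalk y => z ^ p ^ e) '' (Ideal.span (Set.range s) : Set (X₁.presheaf.stalk y)))) →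
              t ∈ Ideal.span (Set.range s))) :
    ∃ (J : X₁.IdealSheafData) (n' : ℕ) (c' : Fin n' → X₁.presheaf.stalk η), J ≠ ⊥ ∧ η ∈ (J.support : Set X₁) ∧
      Ideal.span (Set.range c') ≠ ⊥ ∧ Ideal.span (Set.range c') ≤ maximalIdeal (X₁.presheaf.stalk η) ∧
        (∀ (j : Fin n') (𝔔 : PrimeSpectrum (blowupAlgebra (Ideal.span (Set.range c')) (c' j))),
          𝔔.asIdeal.comap (algebraMap (X₁.presheaf.stalk η) (blowupAlgebra (Ideal.span (Set.range c')) (c' j))) =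
            maximalIdeal (X₁.presheaf.stalk η) →
          IsDomain (Localization.AtPrime 𝔔.asIdeal) ∧ ∀ d : ℕ, ringKrullDim (Localization.AtPrime 𝔔.asIdeal) = d →
            ∀ s : Fin d → Localization.AtPrime 𝔔.asIdeal, (Ideal.span (Set.range s)).radical.IsMaximal →
              RingTheory.Sequence.IsWeaklyRegular (Localization.AtPrime 𝔔.asIdeal) (List.ofFn s) ∧
              ∀ y : Localization.AtPrime 𝔔.asIdeal, (∃ e : ℕ, y ^ p ^ e ∈ Ideal.span ((fun z : Localization.AtPrime 𝔔.asIdeal => z ^ p ^ e) ''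
                (Ideal.span (Set.range s) : Set (Localization.AtPrime 𝔔.asIdeal)))) → y ∈ Ideal.span (Set.range s)) ∧
      stalkIdeal J η = Ideal.span (Set.range c') ∧
      (∀ (X₂ : Scheme.{0}) (π : X₂ ⟶ X₁), IsBlowup π J →
        (∀ x : X₂, π.base x ∈ (J.support : Set X₁) → π.base x ≠ η → ¬ IsClosed ({x} : Set X₂) →
          IsDomain (X₂.presheaf.stalk x) ∧ ∀ d : ℕ, ringKrullDim (X₂.presheaf.stalk x) = d → ∀ s : Fin d → X₂.presheaf.stalk x,
            (Ideal.span (Set.range s)).radical.IsMaximal → RingTheory.Sequence.IsWeaklyRegular (X₂.presheaf.stalk x) (List.ofFn s) ∧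
            ∀ t : X₂.presheaf.stalk x, (∃ e : ℕ, t ^ p ^ e ∈ Ideal.span ((fun z : X₂.presheaf.stalk x => z ^ p ^ e) ''
              (Ideal.span (Set.range s) : Set (X₂.presheaf.stalk x)))) → t ∈ Ideal.span (Set.range s)) ∧
        (∀ x : X₂, π.base x ∈ (J.support : Set X₁) → IsClosed ({x} : Set X₂) →
          ∀ d : ℕ, ringKrullDim (X₂.presheaf.stalk x) = d → ∀ s : Fin d → X₂.presheaf.stalk x,
            (Ideal.span (Set.range s)).radical.IsMaximal → RingTheory.Sequence.IsWeaklyRegular (X₂.presheaf.stalk x) (List.ofFn s))) :=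
  fcUnguarded_of_absorbingStepNC_of_regularOffFinite (AbsorbingStep.absorbingStepNC_of_step h) p hp k X₁ f₁ hs hft hqc hi h4 hCM hA η hη

end Summit.ResolutionOfSingularities.ResolutionOfSingularities.Theorems.FInjectiveMacaulayfication.FiniteResidualOfFourfold

end
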